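import Summits.AtomisticToContinuum.FouriersLaw.Theses.VanishingNoiseTransfer
import Summits.AtomisticToContinuum.FouriersLaw.Theorems.VanishingNoiseTransferVanishingNoiseBoundOfBulkFieldCeiling
import Summits.AtomisticToContinuum.FouriersLaw.Theorems.VanishingNoiseTransferVanishingNoiseBoundStubForwardFieldLeakFree
import Summits.AtomisticToContinuum.FouriersLaw.Theorems.VanishingNoiseTransferVanishingNoiseBoundStubForwardFieldPairRadiation
import Summits.AtomisticToContinuum.FouriersLaw.Theorems.VanishingNoiseBound.Negative.WindowTwoChannel
import Summits.AtomisticToContinuum.FouriersLaw.Theorems.VanishingNoiseBound.Negative.InteriorDarkCarrier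
import Literature.MathematicalPhysics.KineticTheory.VelocityFlipNoise

/-!
# Line `energy-dipole-leak-coercivity` — skeleton v2 (lead a2 reshape) for crux `VanishingNoiseTransfer.VanishingNoiseBound`
(item stmt-AtomisticToContinuum-11976, rank-3 crux of route `route-AtomisticToContinuum-VanishingNoiseTransfer`)

STATUS OF THE LINE. Skeleton v1 (`Lines/energy_dipole_leak_coercivity.lean`, planner crux-plan + lead a1) had three stubs:
S1 `stub_windowTwoChannel` (static windowed two-channel inequality, all `f ∈ L²(μ_T)`), S2 `stub_forwardFieldLeakFree`,
S3 `stub_forwardFieldPairRadiation`. S2 (p132678) and S3 (p132021) are LANDED identities of the forward field; S1 is FALSE,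
kernel-checked: `Theorems.VanishingNoiseBound.Negative.WindowTwoChannel.windowTwoChannel_false` (p132995) — witness the
deterministic equilibrium forward field `g₀` (`exists_plainForwardField_expBound`), which at every finite `L` is exactly
leak-free and radiation-free in every interior window (S2/S3 at `ε = 0`) yet carries the current `∫ g₀ j_i dμ_T = γA₀ − T² < 0`
at every bond. The same witness kills EVERY static reshape (hypotheses that only see interior pairings `∫ f X_Hφ dμ_T`, a
right-hand side vanishing with them), and fixed-`N` continuity `g_ε → g₀` kills every DYNAMIC reshape whose constant and
admissible lengths are uniform in `ε` (at fixed `L`, `(∫ g_ε j_i)² → (γB̂₀)² > 0` while `ε·Σ_x‖g_ε∘F_x − g_ε‖² → 0`).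

THE RESHAPE (this file). What survives of the composition idea — per-bond two-channel estimate × flip dissipation budget, the
flip RATE CANCELLING — is its dynamic BULK form with an `ε`-dependent exclusion radius: the one registered stub

* `stub_bulkTwoChannel` · `∃ ℓ C ≥ 0` (parameters and `T` only) such that for every `ε ∈ (0, 1]` there is `r` (allowed to
  depend on `ε`) with: for every `L ≥ 2`, every classical `C²`, `e^{H/4T}`-bounded forward field `g` of
  `(L_{T,T} + εS) g = −(p_0² − T)` and every bond `i` at distance `≥ r` from both baths (window `W_i = [i−ℓ, i+1+ℓ]`,
  `r + ℓ + 1 ≤ i`, `i + ℓ + r + 3 ≤ L`): `(∫ g j_i dμ_T)² ≤ C · ε · Σ_{x ∈ W_i} ‖g∘F_x − g‖²_{μ_T}`.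
  By S2/S3 (landed, any `ε`) the interior pairings of `g` are `∫ g X_Hφ = ε ∫ g Sφ`: the even leak vanishes and the pair
  radiation is `O(ε × local flip mass)`, which is why the right-hand side carries exactly one factor `ε` — the v1 bet in the
  only form the `g₀` witness (`ε = 0`) and fixed-`N` continuity (`r`, hence `L`, grows as `ε ↓ 0`) cannot touch.
  HONEST SIZE: summing the stub over the bulk bonds against the budget `(ε/2)Σ_x d_x ≤ B̂` shows its best constant is
  `C ≍ T²κ_ε(T)/(2|W|)`; `sup_{ε ≤ 1} C < ∞` is therefore the crux's own content (ε-uniform local Fourier law in the noisy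
  bulk) — crux-sized, recorded as such by the lead (`promote-stub` / dead-line evidence), not hidden.

COMPOSITION (kernel-checked, no `sorry` of its own; LANDED p135343 `…VanishingNoiseBoundOfBulkFieldCeiling.lean` as
`bulkFieldCeiling_of_bulkBondBound` + `vanishingNoiseBound_of_bulkFieldCeiling`): for
`L ≥ L₀(ε) := 4ℓ + 4r(ε) + 8` sum the stub over the `m = L − 2ℓ − 2r − 4 ≥ (L−1)/2` bulk bonds, double-count windows
(`Σ_i Σ_{x∈W_i} d_x ≤ |W| Σ_x d_x`), use the landed bond identity `∫ g j_i = γA − T² = −γB̂` and flip budget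
`ε Σ_x d_x ≤ 2B̂`: `m γ²B̂² ≤ 2C|W| B̂`, whence `(L−1)·γ(1 − γA/T²) = (L−1)γ²B̂/T² ≤ 4C|W|/T² =: K`, uniformly in
`ε ∈ (0,1]` (the rate cancels exactly as in v1; only `L₀` now depends on `ε`, which the crux — a statement about
`lim_N D_N(ε)` at fixed `ε` — tolerates); then dual forward fields of the unique flip-steady family + Kubo link
`D_N/(N−1) = γ(1 − γA/T²)` at every `N ≥ max(L₀(ε), 2)` and `le_of_tendsto`; here only
`VanishingNoiseBound_of : stub_bulkTwoChannel → Theses.VanishingNoiseTransfer.VanishingNoiseBound` (BY NAME; `ε₁ = 1`).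
Landed negatives: `Negative.WindowTwoChannel` (S1 dead, p132995), `Negative.InteriorDarkCarrier` (every static reshape dead,
p135226: interior pairing identity `∫ g X_Hφ = ε∫(Sφ)g` at any `ε`, darkness at `ε = 0`, `staticInteriorCriterion_false`).

Disproof.lean (rev 4) used: §3 `crux_false_without_SBinding` (`subst hS`; the flip-steady equation enters through the landed
dual forward field / Kubo link and is the stub's hypothesis `hpde`); §3 `cruxAt_zero_false_of_exists_unique` (`0 < T`:
`μ_T`, `e^{H/4T}`); §2 `cruxPointwiseAt_holds` (all ε-uniformity sits in `C`; `r`, `L₀` may depend on `ε`); §1d (one `K`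
for all `ε ∈ (0,1]`); §4 `cruxAt_false_harmonic` (for `lam = β = 0` the stub fails with `C(ε) ≍ 1/ε`, exactly as it must);
§1b + p122997 acknowledged: unlike v1, the stub no longer yields `sup_{ε, N ≥ L₀} D_N(ε) < ∞` with uniform `L₀`
(BoundedResponse, stmt-11071) — only `lim sup_N D_N(ε) ≤ K` per `ε`. Landed `Negative/`: `WindowTwoChannel` (imported, S1 dead).
-/

noncomputable section

open MeasureTheory Filter Topology Finset
open Literature.MathematicalPhysics.KineticTheory.HeatConduction
open Summit.AtomisticToContinuum.FouriersLaw.Theorems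
open Summit.AtomisticToContinuum.FouriersLaw.Theorems.SuperadditiveResistance.DeviceLiouville (kin liouvilleOp)
open Summit.AtomisticToContinuum.FouriersLaw.Cruxes.ConductanceLowerBound.ForecastSensitivity
  (memLp_two_of_abs_le_exp)

namespace Summit.AtomisticToContinuum.FouriersLaw.Cruxes.VanishingNoiseBound.EnergyDipoleLeakCoercivity

/-! ## The registered stub (`sorry` lives only here; tree vocabulary only) -/

/-- **Stub · bulkTwoChannel — the line's residual bet, dynamic bulk form (lead a2 reshape of the refuted S1).**
For all parameters `> 0` and `T > 0` there are a window radius `ℓ` and `C ≥ 0` such that for every flip rate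
`ε ∈ (0, 1]` there is an exclusion radius `r` with: for every `L ≥ 2`, every classical `C²` forward field `g`,
`|g| ≤ C₀e^{H/4T}`, of `(L_{T,T} + εS) g = −(p_0² − T)`, and every bond `i` with `r + ℓ + 1 ≤ i`, `i + ℓ + r + 3 ≤ L`
(its window `[i−ℓ, i+1+ℓ]` is interior and at distance `≥ r` from the baths):
`(∫ g j_i dμ_T)² ≤ C · ε · Σ_{x ∈ [i−ℓ, i+1+ℓ]} ∫ (g∘F_x − g)² dμ_T`.
Why plausibly true: in the bulk of a long noisy chain the flip dissipation saturates the entropy budget site by site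
(local equilibrium: `ε d_x ≈ 2B̂/L`) while `(∫ g j_i)² = γ²B̂²` (bond identity), so the inequality holds with
`C ≈ T²κ_ε/(2|W|)`; the landed S2/S3 say the interior pairings of `g` are exactly `ε∫ g Sφ` (leak-free, pair radiation
`O(ε·flip mass)`). Why it might fail / honest size: `sup_ε C < ∞` IS `sup_ε κ_ε(T) < ∞`, the crux's content
(Bernardin–Huveneers–Lebowitz–Liverani–Olla 2015's open question); it fails in the harmonic corner with `C(ε) ≍ 1/ε`
(Disproof §4) and near the baths without the exclusion radius (the `g₀` witness of `Negative.WindowTwoChannel` and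
fixed-`N` continuity). Size: XL (crux-sized). [cite: BernardinOlla2011, Prop. 4 and §3]
[cite: BernardinHuveneersLebowitzLiveraniOlla2015, §1 p. 3] -/
theorem Holds.stub_bulkTwoChannel :
    ∀ ω₂ lam β γ : ℝ, 0 < ω₂ → 0 < lam → 0 < β → 0 < γ → ∀ T : ℝ, 0 < T →
      ∃ (ℓ : ℕ) (C : ℝ), 0 ≤ C ∧ ∀ ε : ℝ, 0 < ε → ε ≤ 1 → ∃ r : ℕ,
        ∀ (L : ℕ), 2 ≤ L → ∀ g : PhaseSpace L → ℝ, ContDiff ℝ 2 g →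
        (∃ C₀ : ℝ, ∀ u, |g u| ≤ C₀ * Real.exp (1 / (4 * T) * (pinnedChain ω₂ lam β γ).hamiltonian L u)) →
        (∀ u, (pinnedChain ω₂ lam β γ).flipGenerator L T T ε g u = -(kin L 0 u - T)) →
        ∀ i : Fin L, r + ℓ + 1 ≤ i.val → i.val + ℓ + r + 3 ≤ L →
        (∫ u, g u * (pinnedChain ω₂ lam β γ).bondCurrent L i u
            ∂((pinnedChain ω₂ lam β γ).gibbsMeasure L T)) ^ 2 ≤
          C * ε * ∑ x : Fin L, if i.val - ℓ ≤ x.val ∧ x.val ≤ i.val + 1 + ℓ then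
              ∫ u, (g (momentumFlip x u) - g u) ^ 2 ∂((pinnedChain ω₂ lam β γ).gibbsMeasure L T) else 0 := by
  sorry

/-- Statement of the registered stub `Holds.stub_bulkTwoChannel`, by name. -/
def stub_bulkTwoChannel : Prop := type_of% Holds.stub_bulkTwoChannel

/-! ## The composition (kernel-checked, no `sorry` of its own; LANDED as p135343
`Theorems/VanishingNoiseTransferVanishingNoiseBoundOfBulkFieldCeiling.lean`: `bulkFieldCeiling_of_bulkBondBound` — the rate
cancellation — and `vanishingNoiseBound_of_bulkFieldCeiling` / `vanishingNoiseBound_of_bulkBondBound` — dual forward fields +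
Kubo link + `le_of_tendsto`; the stub is their hypothesis verbatim) -/

/-- **THE SKELETON THEOREM** (kernel-checked, no `sorry` of its own; the ONLY theorem of this file concluding the crux):
the registered stub — by name — implies `Theses.VanishingNoiseTransfer.VanishingNoiseBound`. It is the landed reduction `vanishingNoiseBound_of_bulkBondBound` (p135343) applied to the stub (the `S`-binding is
`subst`ed there, Disproof §3 `crux_false_without_SBinding`). -/
theorem VanishingNoiseBound_of (h1 : stub_bulkTwoChannel) : Theses.VanishingNoiseTransfer.VanishingNoiseBound :=
  Theorems.VanishingNoiseBound.vanishingNoiseBound_of_bulkBondBound h1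

/-- Shape check (an `example`, so that `VanishingNoiseBound_of` stays the unique theorem concluding the crux): the sorried
stub feeds the by-name hypothesis definitionally; once its `sorry` is discharged this term IS a proof of the crux. -/
example : Theses.VanishingNoiseTransfer.VanishingNoiseBound :=
  VanishingNoiseBound_of Holds.stub_bulkTwoChannel

/-- Record (an `example`): the v1 stub S1 `stub_windowTwoChannel` is refuted in the tree — any future reshape must differ
from it (`Negative.WindowTwoChannel.windowTwoChannel_false`, p132995). -/
example : ¬ (∀ ω₂ lam β γ : ℝ, 0 < ω₂ → 0 < lam → 0 < β → 0 < γ → ∀ T : ℝ, 0 < T →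
      ∃ (ℓ : ℕ) (C : ℝ), 0 ≤ C ∧
        ∀ (L : ℕ) (i : Fin L) (lo hi : ℕ), lo + ℓ = i.val → hi = i.val + 1 + ℓ → 1 ≤ lo → hi + 2 ≤ L →
        ∀ f : PhaseSpace L → ℝ, MemLp f 2 ((pinnedChain ω₂ lam β γ).gibbsMeasure L T) →
        ∀ (ρ₀ : ℝ) (ρ₂ : Fin L → Fin L → ℝ), 0 ≤ ρ₀ → (∀ x y, 0 ≤ ρ₂ x y) →
        (∀ φ : PhaseSpace L → ℝ, ContDiff ℝ ((⊤ : ℕ∞) : WithTop ℕ∞) φ →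
          (∀ u v : PhaseSpace L,
            (∀ k : Fin L, lo ≤ k.val → k.val ≤ hi → u.1 k = v.1 k ∧ u.2 k = v.2 k) → φ u = φ v) →
          (∃ R : ℝ, ∀ u : PhaseSpace L,
            (∃ k : Fin L, lo ≤ k.val ∧ k.val ≤ hi ∧ (R ≤ |u.1 k| ∨ R ≤ |u.2 k|)) → φ u = 0) →
          (∀ (z : Fin L) (u : PhaseSpace L), φ (momentumFlip z u) = φ u) →
          (∫ u, f u * liouvilleOp (pinnedChain ω₂ lam β γ) L φ u
              ∂((pinnedChain ω₂ lam β γ).gibbsMeasure L T)) ^ 2 ≤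
            ρ₀ * ∫ u, φ u ^ 2 ∂((pinnedChain ω₂ lam β γ).gibbsMeasure L T)) →
        (∀ x y : Fin L, lo ≤ x.val → x.val ≤ hi → lo ≤ y.val → y.val ≤ hi →
          ∀ φ : PhaseSpace L → ℝ, ContDiff ℝ ((⊤ : ℕ∞) : WithTop ℕ∞) φ →
          (∀ u v : PhaseSpace L,
            (∀ k : Fin L, (k = x ∨ k = y) → u.1 k = v.1 k ∧ u.2 k = v.2 k) → φ u = φ v) →
          (∃ R : ℝ, ∀ u : PhaseSpace L,
            (R ≤ |u.1 x| ∨ R ≤ |u.2 x| ∨ R ≤ |u.1 y| ∨ R ≤ |u.2 y|) → φ u = 0) →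
          (∀ u, φ (momentumFlip x u) = -φ u) → (∀ u, φ (momentumFlip y u) = -φ u) →
          (∫ u, f u * liouvilleOp (pinnedChain ω₂ lam β γ) L φ u
              ∂((pinnedChain ω₂ lam β γ).gibbsMeasure L T)) ^ 2 ≤
            ρ₂ x y * ∫ u, φ u ^ 2 ∂((pinnedChain ω₂ lam β γ).gibbsMeasure L T)) →
        (∫ u, f u * (pinnedChain ω₂ lam β γ).bondCurrent L i u
            ∂((pinnedChain ω₂ lam β γ).gibbsMeasure L T)) ^ 2 ≤
          C * Real.sqrt (∑ x : Fin L, if lo ≤ x.val ∧ x.val ≤ hi then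
                ∫ u, (f (momentumFlip x u) - f u) ^ 2 ∂((pinnedChain ω₂ lam β γ).gibbsMeasure L T) else 0) *
            Real.sqrt (ρ₀ + ∑ x : Fin L, ∑ y : Fin L,
              if lo ≤ x.val ∧ x.val ≤ hi ∧ lo ≤ y.val ∧ y.val ≤ hi then ρ₂ x y else 0)) :=
  VanishingNoiseBound.Negative.WindowTwoChannel.windowTwoChannel_false

end Summit.AtomisticToContinuum.FouriersLaw.Cruxes.VanishingNoiseBound.EnergyDipoleLeakCoercivity
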